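import Mathlib.RingTheory.Kaehler.Basic
import Mathlib.RingTheory.DiscreteValuationRing.Basic
import Mathlib.RingTheory.LocalRing.ResidueField.Basic
import Mathlib.RingTheory.Length
import Mathlib.RingTheory.QuotSMulTop
import Mathlib.LinearAlgebra.TensorProduct.Quotient
import Mathlib.LinearAlgebra.Dimension.Constructions
import Mathlib.LinearAlgebra.FreeModule.StrongRankCondition
import Mathlib.RingTheory.TensorProduct.Finite
import HarnessLib

/-!
# The fibre dimension of `a*Ω¹` at a point, from local freeness along the centre

Topic: `Literature/AlgebraicGeometry/Smoothening` (Bosch–Lütkebohmert–Raynaud, *Néron Models*,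
§3.3, proof of Prop. 5: the numerics). For a point `a : A → S` of `X = Spec A` with values in a
discrete valuation ring `S` (uniformizer `π`, residue field `k'`) and the pulled-back
differentials `M = a*Ω¹_{X/R} = S ⊗_A Ω[A⁄R]`, the fibre dimension `dim_{k'} (M/πM)` (as an
`S`-length) equals `rank_L (L ⊗_A Ω[A⁄R])` for any `A`-algebra `L` through which the residue
map `A → k'` factors and over which `Ω[A⁄R]` becomes free (`L = 𝒪_{U_k, a_k}`, the local ring of
the centre at the closed point, where `Ω¹_{X/R}|_{U_k}` is locally free of rank `q`):

  `ℓ_S (M/πM) = rank_L (L ⊗_A Ω[A⁄R])`   (`length_quotSMulTop_tensor_kaehler_eq_finrank`).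

Combined with `FibreDimension.finrank_add_one_le_length_quotSMulTop` this gives `q ≥ rank_S M + 1`
at a point where Néron's measure is non-zero. [folklore] bookkeeping; no named facts (D-0026).

## References

* S. Bosch, W. Lütkebohmert, M. Raynaud, *Néron Models*, Springer 1990, §3.3, proof of Prop. 5.
  [BLRNeronModels1990] (Not held; number only.)
-/

noncomputable section

open scoped TensorProduct Pointwise
open IsLocalRing KaehlerDifferential

namespace Literature.AlgebraicGeometry.Smoothening

universe u

variable (R : Type u) [CommRing R] (A : Type u) [CommRing A] [Algebra R A]
  (S : Type u) [CommRing S] [IsDomain S] [IsDiscreteValuationRing S] [Algebra A S] {π : S}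
  (L : Type u) [CommRing L] [Algebra A L]
  [Algebra L (ResidueField S)] [IsScalarTower A L (ResidueField S)]

/-- `M/πM ≅ k' ⊗_A Ω[A⁄R]` for `M = S ⊗_A Ω[A⁄R]` and `k' = S/π`. [folklore] -/
def quotSMulTopTensorKaehlerEquiv (hπ : Irreducible π) :
    QuotSMulTop π (S ⊗[A] Ω[A⁄R]) ≃ₗ[S] ResidueField S ⊗[A] Ω[A⁄R] := by
  have hsmul : (π • ⊤ : Submodule S (S ⊗[A] Ω[A⁄R])) = maximalIdeal S • ⊤ := by
    rw [hπ.maximalIdeal_eq, Submodule.ideal_span_singleton_smul]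
  exact (Submodule.quotEquivOfEq _ _ hsmul) ≪≫ₗ
    (TensorProduct.quotTensorEquivQuotSMul (S ⊗[A] Ω[A⁄R]) (maximalIdeal S)).symm ≪≫ₗ
      (TensorProduct.AlgebraTensorModule.cancelBaseChange A S (ResidueField S) (ResidueField S)
        Ω[A⁄R]).restrictScalars S

/-- **The fibre dimension from local freeness**: `ℓ_S (M/πM) = rank_L (L ⊗_A Ω[A⁄R])` when the
residue map `A → k'` factors through `L` and `L ⊗_A Ω[A⁄R]` is free over `L`. [folklore] -/
theorem length_quotSMulTop_tensor_kaehler_eq_finrank (hπ : Irreducible π)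
    [Module.Free L (L ⊗[A] Ω[A⁄R])] [Module.Finite L (L ⊗[A] Ω[A⁄R])] :
    Module.length S (QuotSMulTop π (S ⊗[A] Ω[A⁄R])) = Module.finrank L (L ⊗[A] Ω[A⁄R]) := by
  haveI : Nontrivial L := (algebraMap L (ResidueField S)).domain_nontrivial
  -- `k' ⊗_A Ω ≅ k' ⊗_L (L ⊗_A Ω)` is finite free over `k'` of rank `rank_L (L ⊗_A Ω)`
  let e := TensorProduct.AlgebraTensorModule.cancelBaseChange A L (ResidueField S) (ResidueField S)
    Ω[A⁄R]
  haveI : Module.Finite (ResidueField S) (ResidueField S ⊗[A] Ω[A⁄R]) :=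
    Module.Finite.of_surjective e.toLinearMap e.surjective
  rw [(quotSMulTopTensorKaehlerEquiv R A S hπ).length_eq,
    Module.length_eq_of_surjective (R := ResidueField S) (M := ResidueField S ⊗[A] Ω[A⁄R])
      residue_surjective,
    Module.length_eq_finrank, ← e.finrank_eq, Module.finrank_baseChange]

end Literature.AlgebraicGeometry.Smoothening
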